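import Summits.RiemannHypothesis.RiemannHypothesis.Theorems.Splittings.LiIncrHighPartModelA
import Summits.RiemannHypothesis.RiemannHypothesis.Theorems.LiCoefficientsLiHeightBudget
import HarnessLib

/-!
# The model main term: `head_small`, `integral_modelW_log_eq`, `model_main_lower`, `tail_small` (RH-free; SketchG6C §8, second half)

Cell rh-split, seat rh-split-li-bridge g6 (brief sha16 f79c5f09d8bcb036), card `run/shared/lean/pub/rh-split/cards/SPLIT-li-bridge.md` §13
(13.5 paper proof «SOUND ON PAPER», referee rh-split-ref g3 06:17:36Z; 13.17); kernel source `HOME/rh-split-li-bridge/SketchG6T.lean` sha16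
911a043700f05677 (2287 l; = SketchG6B [γ] ++ SketchG6C [α][β] ++ Part D [δ] ++ Part T, re-pointed at the tree's `LiIncrMeanSquare` /
`LiIncrBlockLaw`, p508264 / p508611).  Filed by rh-split-typer-2 g4 (lane (xi)(c)–(f)) as a chain of ten tree modules cut at the scratch's
section boundaries, decl text byte-verbatim; deltas = namespaces `RhSplit.LiBridgeG6B/C/D/T` ↦
`…Theorems.Splittings.{LiLowZeroBudget, LiIncrHighPart, LiIncrBlockLawOfRH}` (qualified cross-references rewritten), module docstrings, and
one-line docstrings added where the scratch had none.  END-TO-END statement of the chain (last file):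
`LiIncrBlockLawOfRH.rh_iff_almostAllLiMonotone : RiemannHypothesis ↔ ∃ E ⊆ ℕ of natural density zero, ∀ n ≥ 1, n ∉ E → λ_n ≤ λ_{n+1}`
— T-Li3 IN KERNEL, a RELABELLING of RH (RH-EQUIVALENT, PROVED; certifies nothing about RH; class (li, bridge) unchanged).

This file: §8 (ll. 1750–1981 of the scratch): `head_small`, `integral_modelW_log_eq`, `liMainTerm_succ_sub_ge`, `liC1_ge`, `model_main_lower`, `tail_small`.

Gate dedup delta: the one use of the scratch helper `log_two_pi_bounds` (private in `LiIncrHighPartModelA.lean`) now cites the landed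
`Summit.RiemannHypothesis.RiemannHypothesis.Theorems.LiTheory.Budget.log_two_pi_crude` (same statement; module `LiCoefficientsLiHeightBudget` imported).

HONEST LABEL: «SPLITTING SEARCH over kernel-typed RH-EQUIVALENCES; a splitting A ∧ B ⟹ RH is CONDITIONAL bookkeeping unless A and B are
both proved; nothing here bears on the truth of RH.»
-/

set_option linter.dupNamespace false

noncomputable section

namespace Summit.RiemannHypothesis.RiemannHypothesis.Theorems.Splittings.LiIncrHighPart

open Filter Topology Finset Set MeasureTheory
open scoped Real
open Literature.NumberTheory.LFunctions Literature.NumberTheory.LFunctions.SchoenfeldBound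
open Literature.NumberTheory.DiophantineGeometry
open Summit.RiemannHypothesis.RiemannHypothesis.Theorems.LiTheory
open Summit.RiemannHypothesis.RiemannHypothesis.Theorems.LiTheory.SmoothReplace
open Summit.RiemannHypothesis.RiemannHypothesis.Theorems.LiTheory.Window

/-- `k |∫_0^{k/T'} g_k| ≤ 1` once `T' ≥ 16 (k+2)³` (`k ≥ 1`). -/
theorem head_small {k : ℝ} (hk : 1 ≤ k) {T' : ℝ} (hT : 16 * (k + 2) ^ 3 ≤ T') :
    k * |∫ u in (0 : ℝ)..k / T', gK k u| ≤ 1 := by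
  have hk0 : 0 < k := by linarith
  have hk2 : 0 < k + 2 := by linarith
  have hcube : k ≤ (k + 2) ^ 3 := by nlinarith [sq_nonneg (k + 2), hk2]
  have hT0 : 0 < T' := by nlinarith [pow_pos hk2 3]
  have hkT : k ≤ T' := by nlinarith [pow_pos hk2 3]
  have hε : 0 < k / T' := div_pos hk0 hT0
  have hε1 : k / T' ≤ 1 := by rw [div_le_one hT0]; exact hkT
  have h := abs_head_le k hε hε1
  have hc : |cLog k| ≤ k + 2 :=
    (abs_cLog_le hk).trans (by linarith [Real.log_le_sub_one_of_pos hk0])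
  have h1 : k * (|cLog k| / 2 * (k / T')) ≤ 1 / 32 := by
    have e : k * (|cLog k| / 2 * (k / T')) = k * k * |cLog k| / (2 * T') := by
      field_simp
    rw [e, div_le_div_iff₀ (by positivity) (by norm_num)]
    have hkk : k * k * |cLog k| ≤ (k + 2) ^ 3 := by
      have h3 : k * k * |cLog k| ≤ k * k * (k + 2) := mul_le_mul_of_nonneg_left hc (by positivity)
      nlinarith
    nlinarith
  have h2 : Real.sqrt (k / T') ≤ 1 / (4 * k) := by
    have hle : k / T' ≤ (1 / (4 * k)) ^ 2 := by
      rw [div_le_iff₀ hT0]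
      have e : (1 / (4 * k)) ^ 2 * T' = T' / (16 * k ^ 2) := by
        field_simp
        ring
      rw [e, le_div_iff₀ (by positivity)]
      have h16 : 16 * k ^ 3 ≤ 16 * (k + 2) ^ 3 := by nlinarith [sq_nonneg k, sq_nonneg (k + 2)]
      nlinarith
    calc Real.sqrt (k / T') ≤ Real.sqrt ((1 / (4 * k)) ^ 2) := Real.sqrt_le_sqrt hle
      _ = 1 / (4 * k) := Real.sqrt_sq (by positivity)
  calc k * |∫ u in (0 : ℝ)..k / T', gK k u|
      ≤ k * (|cLog k| / 2 * (k / T') + 2 * Real.sqrt (k / T')) := mul_le_mul_of_nonneg_left h hk0.le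
    _ = k * (|cLog k| / 2 * (k / T')) + 2 * (k * Real.sqrt (k / T')) := by ring
    _ ≤ 1 / 32 + 2 * (k * (1 / (4 * k))) := by
        have := mul_le_mul_of_nonneg_left h2 hk0.le
        linarith
    _ = 1 / 32 + 1 / 2 := by field_simp; norm_num
    _ ≤ 1 := by norm_num

/-- `½∫_Y^{T'} w̃_n log(t/2π) = (n+1)∫_{(n+1)/T'}^{(n+1)/Y} g_{n+1} − n∫_{n/T'}^{n/Y} g_n` (`n ≥ 1`, `0 < Y ≤ T'`). -/
theorem integral_modelW_log_eq {n : ℕ} (hn : 1 ≤ n) {Y T' : ℝ} (hY : 0 < Y) (hYT : Y ≤ T') :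
    ∫ t in Y..T', modelW n t * (Real.log (t / (2 * π)) / 2) =
      ((n : ℝ) + 1) * (∫ u in ((n : ℝ) + 1) / T'..((n : ℝ) + 1) / Y, gK ((n : ℝ) + 1) u)
        - n * ∫ u in (n : ℝ) / T'..(n : ℝ) / Y, gK n u := by
  have hn0 : (0 : ℝ) < n := by exact_mod_cast hn
  have hn1 : (0 : ℝ) < (n : ℝ) + 1 := by linarith
  have hπ := Real.pi_pos
  have hci : ∀ k : ℝ, IntervalIntegrable
      (fun t : ℝ ↦ (1 - Real.cos (k / t)) * Real.log (t / (2 * π))) volume Y T' := by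
    intro k
    refine (continuousOn_of_forall_continuousAt fun t ht ↦ ?_).intervalIntegrable
    rw [uIcc_of_le hYT] at ht
    have ht0 : t ≠ 0 := by linarith [ht.1]
    have ht' : t / (2 * π) ≠ 0 := by
      have : 0 < t := by linarith [ht.1]
      positivity
    fun_prop (disch := assumption)
  rw [← integral_model_piece hn1 hY hYT, ← integral_model_piece hn0 hY hYT,
    ← intervalIntegral.integral_sub (hci _) (hci _)]
  apply intervalIntegral.integral_congr
  intro t _
  simp only [modelW]
  ring

/-- `liMainTerm(n+1) − liMainTerm(n) ≥ ½ log n + C₁`. -/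
theorem liMainTerm_succ_sub_ge {n : ℕ} (hn : 1 ≤ n) :
    Real.log n / 2 + liC1 ≤ liMainTerm (n + 1) - liMainTerm n := by
  have hn1 : (1 : ℝ) ≤ n := by exact_mod_cast hn
  have hlog : Real.log n ≤ Real.log ((n : ℝ) + 1) := Real.log_le_log (by linarith) (by linarith)
  have hlog0 : 0 ≤ Real.log n := Real.log_nonneg hn1
  unfold liMainTerm
  push_cast
  nlinarith [mul_le_mul_of_nonneg_left hlog (by linarith : (0 : ℝ) ≤ ((n : ℝ) + 1) / 2)]

/-- `C₁ = (γ − 1 − log 2π)/2 ≥ −5/4`. -/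
theorem liC1_ge : -(5 / 4 : ℝ) ≤ liC1 := by
  have hγ := Real.one_half_lt_eulerMascheroniConstant
  obtain ⟨-, h2⟩ := Summit.RiemannHypothesis.RiemannHypothesis.Theorems.LiTheory.Budget.log_two_pi_crude
  unfold liC1
  linarith

/-- **The model main term from below:** for `n ≥ 1`, `1 ≤ Y ≤ n`, `T' ≥ max(Y, 16(n+3)³)`,
`½∫_Y^{T'} w̃_n log(t/2π) ≥ π(liMainTerm(n+1) − liMainTerm n) − 2 − tailErr`, the tails of `k = n, n+1`
combined with cancellation. -/
theorem model_main_lower {n : ℕ} (hn : 1 ≤ n) {Y T' : ℝ} (hY : 1 ≤ Y) (hYn : Y ≤ n)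
    (hT : 16 * ((n : ℝ) + 3) ^ 3 ≤ T') (hYT : Y ≤ T') :
    π * (liMainTerm (n + 1) - liMainTerm n) - 2
      - (2 * |cLog ((n : ℝ) + 1)| / (((n : ℝ) + 1) / Y) + 8 / Real.sqrt (((n : ℝ) + 1) / Y)
          + 2 / (((n : ℝ) + 1) / Y)
          + n * ((((n : ℝ) + 1) / Y - n / Y) *
              (2 * (|cLog n| + Real.log (((n : ℝ) + 1) / Y)) / ((n : ℝ) / Y) ^ 2)))
      ≤ ∫ t in Y..T', modelW n t * (Real.log (t / (2 * π)) / 2) := by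
  have hn1 : (1 : ℝ) ≤ n := by exact_mod_cast hn
  have hn0 : (0 : ℝ) < n := by linarith
  have hk1 : (0 : ℝ) < (n : ℝ) + 1 := by linarith
  have hY0 : 0 < Y := by linarith
  have hT0 : 0 < T' := by linarith
  -- sizes
  have hε₀ : 0 < (n : ℝ) / T' := div_pos hn0 hT0
  have hε₁ : 0 < ((n : ℝ) + 1) / T' := div_pos hk1 hT0
  have hU₀ : 1 ≤ (n : ℝ) / Y := by rw [le_div_iff₀ hY0]; linarith
  have hU₀₁ : (n : ℝ) / Y ≤ ((n : ℝ) + 1) / Y := div_le_div_of_nonneg_right (by linarith) hY0.le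
  have hU₁ : 1 ≤ ((n : ℝ) + 1) / Y := hU₀.trans hU₀₁
  have hU₀pos : 0 < (n : ℝ) / Y := by linarith
  have hU₁pos : 0 < ((n : ℝ) + 1) / Y := by linarith
  have hεU₀ : (n : ℝ) / T' ≤ (n : ℝ) / Y := div_le_div_of_nonneg_left hn0.le hY0 hYT
  have hεU₁ : ((n : ℝ) + 1) / T' ≤ ((n : ℝ) + 1) / Y := div_le_div_of_nonneg_left hk1.le hY0 hYT
  rw [integral_modelW_log_eq hn hY0 hYT, integral_gK_split ((n : ℝ) + 1) hε₁.le hεU₁,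
    integral_gK_split (n : ℝ) hε₀.le hεU₀]
  -- full terms
  have hF1 : ((n : ℝ) + 1) * ∫ u in Ioi 0, gK ((n : ℝ) + 1) u = π * liMainTerm (n + 1) := by
    have h := mul_integral_gK_Ioi (k := n + 1) (by omega)
    push_cast at h
    exact h
  have hF0 : (n : ℝ) * ∫ u in Ioi 0, gK n u = π * liMainTerm n := mul_integral_gK_Ioi hn
  -- heads
  have hT1 : 16 * (((n : ℝ) + 1) + 2) ^ 3 ≤ T' := by
    have : ((n : ℝ) + 1) + 2 = (n : ℝ) + 3 := by ring
    rw [this]; exact hT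
  have hT0' : 16 * ((n : ℝ) + 2) ^ 3 ≤ T' := by nlinarith [sq_nonneg ((n : ℝ) + 2)]
  have hH1 := head_small (k := (n : ℝ) + 1) (by linarith) hT1
  have hH0 := head_small (k := (n : ℝ)) hn1 hT0'
  have hH1' := abs_le.1 ((abs_mul _ _).trans_le (by rwa [abs_of_pos hk1]) :
    |((n : ℝ) + 1) * ∫ u in (0 : ℝ)..((n : ℝ) + 1) / T', gK ((n : ℝ) + 1) u| ≤ 1)
  have hH0' := abs_le.1 ((abs_mul _ _).trans_le (by rwa [abs_of_pos hn0]) :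
    |(n : ℝ) * ∫ u in (0 : ℝ)..(n : ℝ) / T', gK n u| ≤ 1)
  -- tails
  have hTl1 := abs_le.1 (abs_tail_le' ((n : ℝ) + 1) hU₁)
  have hdiff := tail_sub_tail (n : ℝ) ((n : ℝ) + 1) hU₁pos
  have hI := integral_one_sub_cos_tail_bounds hU₁pos
  have hc01 : 0 ≤ cLog ((n : ℝ) + 1) - cLog n ∧ cLog ((n : ℝ) + 1) - cLog n ≤ 1 / n := by
    have e : cLog ((n : ℝ) + 1) - cLog n = Real.log (((n : ℝ) + 1) / n) := by
      unfold cLog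
      rw [Real.log_div hk1.ne' (by positivity), Real.log_div hn0.ne' (by positivity),
        Real.log_div hk1.ne' hn0.ne']
      ring
    rw [e]
    constructor
    · exact Real.log_nonneg (by rw [le_div_iff₀ hn0]; linarith)
    · have h := Real.log_le_sub_one_of_pos (x := ((n : ℝ) + 1) / n) (by positivity)
      have e2 : ((n : ℝ) + 1) / n - 1 = 1 / n := by
        field_simp
        ring
      linarith
  have hmid : 0 ≤ (n : ℝ) * ((cLog ((n : ℝ) + 1) - cLog n) * ∫ u in Ioi (((n : ℝ) + 1) / Y),
      (1 - Real.cos u) / u ^ 2) ∧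
      (n : ℝ) * ((cLog ((n : ℝ) + 1) - cLog n) * ∫ u in Ioi (((n : ℝ) + 1) / Y),
        (1 - Real.cos u) / u ^ 2) ≤ 2 / (((n : ℝ) + 1) / Y) := by
    constructor
    · exact mul_nonneg hn0.le (mul_nonneg hc01.1 hI.1)
    · calc (n : ℝ) * ((cLog ((n : ℝ) + 1) - cLog n) * ∫ u in Ioi (((n : ℝ) + 1) / Y),
            (1 - Real.cos u) / u ^ 2)
          ≤ (n : ℝ) * ((1 / n) * (2 / (((n : ℝ) + 1) / Y))) :=
            mul_le_mul_of_nonneg_left (mul_le_mul hc01.2 hI.2 hI.1 (by positivity)) hn0.le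
        _ = 2 / (((n : ℝ) + 1) / Y) := by field_simp
  have hdiff' : (n : ℝ) * (∫ u in Ioi (((n : ℝ) + 1) / Y), gK ((n : ℝ) + 1) u)
      - (n : ℝ) * (∫ u in Ioi (((n : ℝ) + 1) / Y), gK n u) =
      (n : ℝ) * ((cLog ((n : ℝ) + 1) - cLog n) * ∫ u in Ioi (((n : ℝ) + 1) / Y),
        (1 - Real.cos u) / u ^ 2) := by
    rw [← mul_sub, hdiff]
  have hsplit0 : (n : ℝ) * (∫ u in Ioi ((n : ℝ) / Y), gK n u) =
      (n : ℝ) * (∫ u in (n : ℝ) / Y..((n : ℝ) + 1) / Y, gK n u)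
        + (n : ℝ) * ∫ u in Ioi (((n : ℝ) + 1) / Y), gK n u := by
    have h := intervalIntegral.integral_Ioi_sub_Ioi
      ((integrableOn_gK (n : ℝ)).mono_set (Ioi_subset_Ioi hU₀pos.le)) hU₀₁
    rw [← mul_add]
    congr 1
    linarith
  have hloc := abs_le.1 ((abs_mul _ _).trans_le
    ((congrArg (· * _) (abs_of_pos hn0)).le.trans
      (mul_le_mul_of_nonneg_left (abs_integral_gK_local_le (n : ℝ) hU₀ hU₀₁) hn0.le)) :
    |(n : ℝ) * ∫ u in (n : ℝ) / Y..((n : ℝ) + 1) / Y, gK n u| ≤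
      n * ((((n : ℝ) + 1) / Y - n / Y) *
        (2 * (|cLog n| + Real.log (((n : ℝ) + 1) / Y)) / ((n : ℝ) / Y) ^ 2)))
  linarith [hF1, hF0, hH1'.1, hH1'.2, hH0'.1, hH0'.2, hTl1.1, hTl1.2, hmid.1, hmid.2, hdiff',
    hsplit0, hloc.1, hloc.2]

/-- The tail error is `≤ 6` once `4Y(log(n+1) + 2) ≤ n` (`n ≥ 1`, `Y ≥ 1`). -/
theorem tail_small {n : ℕ} (hn : 1 ≤ n) {Y : ℝ} (hY : 1 ≤ Y)
    (hYn : 4 * Y * (Real.log ((n : ℝ) + 1) + 2) ≤ n) :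
    2 * |cLog ((n : ℝ) + 1)| / (((n : ℝ) + 1) / Y) + 8 / Real.sqrt (((n : ℝ) + 1) / Y)
        + 2 / (((n : ℝ) + 1) / Y)
        + n * ((((n : ℝ) + 1) / Y - n / Y) *
            (2 * (|cLog n| + Real.log (((n : ℝ) + 1) / Y)) / ((n : ℝ) / Y) ^ 2)) ≤ 6 := by
  have hn1 : (1 : ℝ) ≤ n := by exact_mod_cast hn
  have hn0 : (0 : ℝ) < n := by linarith
  have hY0 : 0 < Y := by linarith
  have hL0 : 0 < Real.log ((n : ℝ) + 1) := Real.log_pos (by linarith)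
  have hlogn : Real.log n ≤ Real.log ((n : ℝ) + 1) := Real.log_le_log hn0 (by linarith)
  have hlogn0 : 0 ≤ Real.log n := Real.log_nonneg hn1
  have hc1 : |cLog ((n : ℝ) + 1)| ≤ Real.log ((n : ℝ) + 1) + 2 := abs_cLog_le (by linarith)
  have hc0 : |cLog n| ≤ Real.log n + 2 := abs_cLog_le hn1
  have hYn8 : 8 * Y ≤ n := by nlinarith
  have hk1 : (0 : ℝ) < (n : ℝ) + 1 := by linarith
  -- term 1
  have t1 : 2 * |cLog ((n : ℝ) + 1)| / (((n : ℝ) + 1) / Y) ≤ 1 / 2 := by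
    rw [div_div_eq_mul_div, div_le_iff₀ hk1]
    have := mul_le_mul_of_nonneg_right hc1 hY0.le
    nlinarith
  -- term 2
  have t2 : 8 / Real.sqrt (((n : ℝ) + 1) / Y) ≤ 4 := by
    have h4 : (2 : ℝ) ≤ Real.sqrt (((n : ℝ) + 1) / Y) := by
      have h4' : (2 : ℝ) ^ 2 ≤ ((n : ℝ) + 1) / Y := by
        rw [le_div_iff₀ hY0]
        nlinarith
      calc (2 : ℝ) = Real.sqrt (2 ^ 2) := (Real.sqrt_sq (by norm_num)).symm
        _ ≤ Real.sqrt (((n : ℝ) + 1) / Y) := Real.sqrt_le_sqrt h4'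
    rw [div_le_iff₀ (by linarith)]
    linarith
  -- term 3
  have t3 : 2 / (((n : ℝ) + 1) / Y) ≤ 1 / 4 := by
    rw [div_div_eq_mul_div, div_le_iff₀ hk1]
    nlinarith
  -- term 4
  have hlogU : Real.log (((n : ℝ) + 1) / Y) ≤ Real.log ((n : ℝ) + 1) := by
    rw [Real.log_div hk1.ne' hY0.ne']
    linarith [Real.log_nonneg hY]
  have t4 : n * ((((n : ℝ) + 1) / Y - n / Y) *
      (2 * (|cLog n| + Real.log (((n : ℝ) + 1) / Y)) / ((n : ℝ) / Y) ^ 2)) ≤ 1 := by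
    have e : n * ((((n : ℝ) + 1) / Y - n / Y) *
        (2 * (|cLog n| + Real.log (((n : ℝ) + 1) / Y)) / ((n : ℝ) / Y) ^ 2)) =
        2 * (|cLog n| + Real.log (((n : ℝ) + 1) / Y)) * Y / n := by
      field_simp
      ring
    rw [e, div_le_iff₀ hn0]
    have h : |cLog n| + Real.log (((n : ℝ) + 1) / Y) ≤ 2 * (Real.log ((n : ℝ) + 1) + 2) := by
      linarith
    nlinarith [mul_le_mul_of_nonneg_right h (by linarith : (0 : ℝ) ≤ 2 * Y)]
  linarith

end Summit.RiemannHypothesis.RiemannHypothesis.Theorems.Splittings.LiIncrHighPart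

end
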